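import Summits.QuantumFields.YangMills.Theorems.FluctuationComparisonRegPrIntLS2BetaChartContLaplaceRows
import Summits.QuantumFields.YangMills.Theorems.FluctuationComparisonRegPrIntLS2BetaChartContWindowChartJoint
import HarnessLib

/-!
# CHART∞ · V-c3ʲ (LINE g18-1 `semiclassical_s2beta`, LAPLACE row): `exists_laplaceRows₂` — the rows of record PLUS joint continuity on the live graph
Cell `ym3-torus` (rung R3: `SU(2)` Yang–Mills on `T³` — NOT `d = 4`, NOT infinite volume, NOT a mass gap, NOT Clay); width seat `ym-ust-20520-w3` g16; helper of
`stmt-QuantumFields-20520` (`--supports`, NOT a proof of it); THEOREMS ONLY (0 `def`, default heartbeats).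
★★★ `exists_laplaceRows₂` = ✓V-c3 `exists_laplaceRows` (the window chart of record `c` with its fourteen exported clauses and, at every `V`, the nine LIMIT-INST rows
for `act := pivotAct F hJK (iterCentralBond (K − J))`, `Xc := {z | c.jac (V, z) ≠ 0}` — proof re-run verbatim on ✓V-c2ʲ `exists_windowChart_cont_joint`) PLUS ONE
CLAUSE, inserted after the recognition clause: **`ContinuousOn (fun q => c.Φ q) {q | c.jac q ≠ 0} ∧ ContinuousOn (fun q => c.jac q) {q | c.jac q ≠ 0}`** —
JOINT continuity of the chart of record and of its Jacobian on the live graph `{q | c.jac q ≠ 0}` (the (j1)-WITHIN row of w4-20520 g16's v11.2 (3) and the binder of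
w5-20520 g14's C2″-WITHIN door `contDiffAt_wilsonAction4_windowChart_param_within`; `ContinuousWithinAt (fun q => c.Φ q) {q | c.jac q ≠ 0} q₀` at a live `q₀` is
`(h.1) q₀ hq₀`).  NOT exported (not in the landed chain, see w3-20520 g16 23:26Z): `ContinuousAt` off the graph and joint OPENNESS of the live graph — these need a
parametric open-mapping lemma for the tube graph.  HONEST: re-threading, no new estimate; LAPLACE ∕ S2β ∕ crux 20520 ∕ `YM3TorusSU2` ∕ Clay NOT proved.
[cite: Balaban1987RG1, (0.4) p.253, (2.4) p.266 and (2.10) p.267] [cite: Balaban1985Averaging, (8) p.19 and (11) p.19] [cite: Balaban1985UV3, (7) p.257]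
-/

noncomputable section

open MeasureTheory Filter Topology Set
open scoped ENNReal NNReal
open Literature.MathematicalPhysics.QuantumFieldTheory.Balaban1983to89 T3ContinuumYM3Torus T3UnitLawDensityEML T3UnitScaleTilt T3TiltDescent
  T3PrintedRegularOrbits T3LevelShift T3Thresholds T4Continuum
open scoped Literature.MathematicalPhysics.QuantumFieldTheory.Balaban1983to89.T3OrbitAverage

namespace Summit.QuantumFields.YangMills.Theorems.FluctuationComparisonRegPrIntLS2BetaChartContLaplaceRowsJoint

open Summit.QuantumFields.YangMills.Theorems FluctuationComparisonRegPrIntLWregChain FluctuationComparisonRegPrIntLWregGlue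
  FluctuationComparisonRegPrIntLWregInterior FluctuationComparisonRegPrIntLS2BetaResidualSubgroup FluctuationComparisonRegPrIntLS2BetaChartContLaplaceRows
open Summit.QuantumFields.YangMills.Theorems.FluctuationComparisonRegPrIntLS2BetaChartContCarrier (isOpen_coe_preimage_of_continuousOn)
open Summit.QuantumFields.YangMills.Theorems.FluctuationComparisonRegPrIntLS2BetaResidualGauge (wilsonAction4_gaugeAct gaugeAct_const_of_comm)
open Function

/-- ★★★ **THE ROWS OF RECORD PLUS JOINT CONTINUITY ON THE LIVE GRAPH, HYPOTHESIS-FREE** (= ✓`exists_laplaceRows` ⊕ the clause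
`ContinuousOn (fun q => c.Φ q) {q | c.jac q ≠ 0} ∧ ContinuousOn (fun q => c.jac q) {q | c.jac q ≠ 0}` after the recognition clause).
[cite: Balaban1987RG1, (0.4) p.253, (2.4) p.266 and (2.10) p.267] [cite: Balaban1985Averaging, (8) p.19 and (11) p.19] [cite: Balaban1985UV3, (7) p.257] -/
theorem exists_laplaceRows₂ :
    ∀ (L : ℕ) (b₀ p₀ : ℝ), 0 < b₀ → 0 < p₀ → ∃ γ₁ : ℝ, 0 < γ₁ ∧ ∀ (F : T3Family) (γ : ℝ), F.L = L → 0 < γ → γ ≤ γ₁ →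
      ∀ (J K : ℕ) (hJK : J ≤ K),
        ∃ (c : WindowChart F hJK (histGood F ℰp (θBal F.L γ b₀ p₀) K J) {V | PlaqSmall (θBal F.L γ b₀ p₀ J) V})
          (T : PBond (F.P K) (K - J) → GaugeField (F.P K) 0 (Matrix.specialUnitaryGroup (Fin 2) ℂ) → Set (Matrix.specialUnitaryGroup (Fin 2) ℂ))
          (w : PBond (F.P K) (K - J) → PBond (F.P J) 0),
          (∀ V z, c.jac (V, z) ≠ 0 → descendTo F ℰp J K hJK (c.Φ (V, z)) = V) ∧
          (∀ V z, c.jac (V, z) ≠ 0 ↔ (∀ c', V (w c') ∈ T c' z) ∧ c.Φ (V, z) ∈ closure (histGood F ℰp (θBal F.L γ b₀ p₀) K J)) ∧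
          (∀ V, ContinuousOn (fun z => c.Φ (V, z)) {z | c.jac (V, z) ≠ 0} ∧ ContinuousOn (fun z => c.jac (V, z)) {z | c.jac (V, z) ≠ 0}) ∧
          (∀ c' z (g : PBond (F.P K) (K - J) → Matrix.specialUnitaryGroup (Fin 2) ℂ), T c' (Function.extend (iterCentralBond (K - J)) g z) = T c' z) ∧
          (∀ V z (g : PBond (F.P K) (K - J) → Matrix.specialUnitaryGroup (Fin 2) ℂ), c.jac (V, Function.extend (iterCentralBond (K - J)) g z) = c.jac (V, z)) ∧
          (∀ V z (g : PBond (F.P K) (K - J) → Matrix.specialUnitaryGroup (Fin 2) ℂ), c.jac (V, z) ≠ 0 →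
            c.Φ (V, Function.extend (iterCentralBond (K - J)) g z) = c.Φ (V, z)) ∧
          (∀ V U, descendTo F ℰp J K hJK U = V → U ∈ closure (histGood F ℰp (θBal F.L γ b₀ p₀) K J) → c.jac (V, U) ≠ 0 ∧ c.Φ (V, U) = U) ∧
          (∀ V z, (∀ c', V (w c') ∈ T c' z) → (∀ b, (∀ c', iterCentralBond (K - J) c' ≠ b) → c.Φ (V, z) b = z b) ∧
            descendTo F ℰp J K hJK (c.Φ (V, z)) = V) ∧
          (∀ (u : GaugeTransf (F.P K) 0 (Matrix.specialUnitaryGroup (Fin 2) ℂ)),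
            (∀ V' : GaugeField (F.P K) (K - J) (Matrix.specialUnitaryGroup (Fin 2) ℂ), GaugeField.gaugeAct (transfUp u (K - J)) V' = V') →
            ∀ V z, c.jac (V, GaugeField.gaugeAct u z) = c.jac (V, z) ∧
              (c.jac (V, z) ≠ 0 → c.Φ (V, GaugeField.gaugeAct u z) = GaugeField.gaugeAct u (c.Φ (V, z)))) ∧
          (∀ (k : residualSubgroup F hJK) (V' : GaugeField (F.P K) (K - J) (Matrix.specialUnitaryGroup (Fin 2) ℂ)),
            GaugeField.gaugeAct (transfUp (k : Site (F.P K) 0 → Matrix.specialUnitaryGroup (Fin 2) ℂ) (K - J)) V' = V') ∧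
          (∀ V U, descendTo F ℰp J K hJK U = V → U ∈ histGood F ℰp (θBal F.L γ b₀ p₀) K J → {z | c.jac (V, z) ≠ 0} ∈ 𝓝 U) ∧
          (∀ V z U', U' ∈ closure (histGood F ℰp (θBal F.L γ b₀ p₀) K J) → descendTo F ℰp J K hJK U' = V →
            (∀ b, (∀ c', iterCentralBond (K - J) c' ≠ b) → U' b = z b) → c.jac (V, z) ≠ 0 ∧ c.Φ (V, z) = U') ∧
          (ContinuousOn (fun q => c.Φ q) {q | c.jac q ≠ 0} ∧ ContinuousOn (fun q => c.jac q) {q | c.jac q ≠ 0}) ∧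
          ∀ V : GaugeField (F.P J) 0 (Matrix.specialUnitaryGroup (Fin 2) ℂ),
            IsCompact {z | c.jac (V, z) ≠ 0} ∧
            (∀ k z, z ∈ {z | c.jac (V, z) ≠ 0} → pivotAct F hJK (iterCentralBond (K - J)) k z ∈ {z | c.jac (V, z) ≠ 0}) ∧
            (∀ z, z ∉ {z | c.jac (V, z) ≠ 0} → (c.jac (V, z) : ℝ) = 0) ∧
            ContinuousOn (fun z => wilsonAction4 (c.Φ (V, z))) {z | c.jac (V, z) ≠ 0} ∧
            ContinuousOn (fun z => (c.jac (V, z) : ℝ)) {z | c.jac (V, z) ≠ 0} ∧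
            (∀ k, ∀ z ∈ {z | c.jac (V, z) ≠ 0},
              wilsonAction4 (c.Φ (V, pivotAct F hJK (iterCentralBond (K - J)) k z)) = wilsonAction4 (c.Φ (V, z))) ∧
            (∀ k, ∀ z ∈ {z | c.jac (V, z) ≠ 0}, (c.jac (V, pivotAct F hJK (iterCentralBond (K - J)) k z) : ℝ) = c.jac (V, z)) ∧
            IsOpen ((Subtype.val : {z | c.jac (V, z) ≠ 0} → GaugeField (F.P K) 0 (Matrix.specialUnitaryGroup (Fin 2) ℂ)) ⁻¹'
              {z | c.Φ (V, z) ∈ histGood F ℰp (θBal F.L γ b₀ p₀) K J}) ∧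
            (∀ k, ∀ z ∈ {z | c.jac (V, z) ≠ 0}, c.Φ (V, z) ∈ histGood F ℰp (θBal F.L γ b₀ p₀) K J →
              c.Φ (V, pivotAct F hJK (iterCentralBond (K - J)) k z) ∈ histGood F ℰp (θBal F.L γ b₀ p₀) K J) := by
  intro L b₀ p₀ hb hp
  obtain ⟨γ₁, hγ₁, hmain⟩ :=
    Summit.QuantumFields.YangMills.Theorems.FluctuationComparisonRegPrIntLS2BetaChartContWindowChartJoint.exists_windowChart_cont_joint L b₀ p₀ hb hp
  obtain ⟨δ', γ₂, hδ', hγ₂, hreg⟩ := Summit.QuantumFields.YangMills.Theorems.FluctuationComparisonRegPrIntLWregAssembly.exists_gamma_levelRegime L b₀ p₀ hb hp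
  refine ⟨min γ₁ γ₂, lt_min hγ₁ hγ₂, fun F γ hFL hγ hγle J K hJK => ?_⟩
  obtain ⟨c, T, w, hfib, hne, hcompact, hcontOn, hTbl, hjbl, hΦbl, hself, hcharted, hcov, hnhds, hrecog, hjoint⟩ :=
    hmain F γ hFL hγ (hγle.trans (min_le_left _ _)) J K hJK
  obtain ⟨hsmall, hθlt⟩ := hreg F γ hFL hγ (hγle.trans (min_le_right _ _)) K
  refine ⟨c, T, w, hfib, hne, hcontOn, hTbl, hjbl, hΦbl, hself, hcharted, hcov, gaugeAct_transfUp_eq_self_of_residual F hJK, hnhds, hrecog, hjoint,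
    fun V => ?_⟩
  exact laplaceRows_of_carrier F hJK hδ'.le (fun i => (hθlt i).le) hsmall c hcompact hcontOn hjbl hΦbl
    (fun k V z => (hcov (k : Site (F.P K) 0 → Matrix.specialUnitaryGroup (Fin 2) ℂ) (gaugeAct_transfUp_eq_self_of_residual F hJK k) V z).1)
    (fun k V z hj => (hcov (k : Site (F.P K) 0 → Matrix.specialUnitaryGroup (Fin 2) ℂ) (gaugeAct_transfUp_eq_self_of_residual F hJK k) V z).2 hj) V

end Summit.QuantumFields.YangMills.Theorems.FluctuationComparisonRegPrIntLS2BetaChartContLaplaceRowsJoint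

end
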